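import Literature.NumberTheory.EllipticCurves.GeomPointsEmbeddingDescent
import Literature.NumberTheory.EllipticCurves.RingClassFieldSplitting
import Literature.NumberTheory.EllipticCurves.NeronOggShafarevichLocal
import Literature.NumberTheory.EllipticCurves.HeegnerPointsKolyvaginPrimaryUnramifiedProofs
import Mathlib.NumberTheory.RamificationInertia.Galois
import Mathlib.NumberTheory.RamificationInertia.Unramified
import HarnessLib

/-!
# Inertia at an unramified place fixes an embedded Galois extension; ring class fields; Gross's
# Prop. 6.2 (1) for cubic-twist (CM-frame) Kolyvagin classes at the good places

Topic `NumberTheory/EllipticCurves`; namespace `Literature.NumberTheory.EllipticCurves` (§3 in the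
sub-namespace `JZero` of `CubicTwistTransportJZero`). Theorems only: **no definition, no named fact**
(D-0026).

* §1 **Inertia at an unramified place.**  `K` a number field, `L/K` finite Galois with an embedding
  `emb : L → K̄` over `K`, `N ≤ Γ_K` any subgroup with `g ∈ N ↔ g ∘ emb = emb` (`= Gal(K̄/emb L)`; the
  convention `hN` of `GeomPointsEmbeddingDescent`), `v` a finite place of `K` UNRAMIFIED in `L`
  (`Algebra.IsUnramifiedIn (𝓞 L) v`).  Then every inertia group above `v` lies in `N`: globally
  (`mem_of_mem_inertia_of_isUnramifiedIn`: `I_𝔓 ≤ N` for every prime `𝔓` of `\bar ℤ_K` above `v`) and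
  locally (`resGal_mem_of_mem_localInertia_of_isUnramifiedIn`: the restriction `Γ_{K_v} → Γ_K` maps the
  inertia group of every prime `𝔐` of `\bar 𝓞_v` into `N`).  Proof = the pointwise content of the
  tree's cofinite statement `eventually_forall_inertia_mem_fixingSubgroup`
  (`LocalGlobalCohomologyProofs`): `g ∈ I_𝔓` restricts (`exists_algEquiv_comp_eq`) to `σ ∈ Gal(L/K)` in
  the inertia group of `P = 𝔓 ∩ 𝓞 L`, which is trivial because `#I(P|v) = e(P|v) = 1` (Mathlib
  `Ideal.card_inertia_eq_ramificationIdxIn`, `Ideal.ramificationIdx_eq_one_of_isUnramifiedAt`); the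
  local form is the tree's `resGalOfEmb_mem_inertia_primeBelow` (Neukirch II (9.6)).
* §2 **Ring class fields** `K[f]` of an imaginary quadratic `K` are unramified outside `f` (Cox §9.A;
  tree `isUnramifiedIn_ringClassField`), so for `v ∤ f` the local inertia above `v` lies in
  `Gal(K̄/emb K[f])` (`resGal_mem_of_mem_localInertia_ringClassField`).
* §3 **Gross's Prop. 6.2 (1) for cubic-twist classes.**  For the transport `ψ : E(K̄) ≃ E'(K̄)`,
  `(x, y) ↦ (v²x, v³y)`, of `CubicTwistTransportJZero` and a subgroup `N` fixing `v`, an `N`-fixed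
  point `Q` has `ψ Q` fixed by every `g ∈ N` (`JZero.forall_smul_cubicTwist_eq_iff`); so if the local
  inertia at a place `w` of good reduction for `E'` restricts into `N`, the tree's
  `kolyvaginClass_mem_selmerLocalKer_of_inertia` (Milne *ADT* I.3.8, discharged) puts Kolyvagin's class
  of `ψ Q` in the Selmer local condition at `w`
  (`JZero.kolyvaginClass_cubicTwist_mem_selmerLocalKer_of_inertia`); with §2, **for `N = Gal(K̄/emb K[f])`
  this holds at every good place `w ∤ f`** (`JZero.kolyvaginClass_cubicTwist_mem_selmerLocalKer_of_ringClassField`)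
  — the CM-frame classes of `HuShuYin2019.exists_cmFrame_kolyvaginClass` (crux `UpperOffV0HSYPlus`,
  stmt-BirchSwinnertonDyer-19804; tower field `K[9pn]`) at the places `w ∤ 3pn` of good reduction, i.e.
  the «`v ∤ 6pn`» and «`v = 2`» items of cell memo MEMO-bsd-cm-two §57.3 «LOCAL BEHAVIOUR OFF n» once
  `E'` has good reduction there (sibling file `HuShuYin2019/SylvesterPairGoodPlaces`).

Nothing is asserted about Selmer groups beyond these memberships; BSD is not claimed.

## References

* [NeukirchANT1999] J. Neukirch, *Algebraic Number Theory* (1999), Ch. I §9 (Prop. (9.6): `#I_𝔓 = e`,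
  `I_𝔓 = 1 ⟺ 𝔭` unramified), Ch. II §9 ((9.4)–(9.6)).
* [Cox2013] D. A. Cox, *Primes of the form x² + ny²*, 2nd ed. (2013), §9.A (p. 181: all primes of `K`
  ramified in the ring class field divide `f𝒪_K`), §11.A Thm. 11.1.
* [GrossLMS1991] B. H. Gross, *Kolyvagin's work on modular elliptic curves*, LMS LNS 153 (1991),
  Prop. 6.2 (1).
* [McCallumLMS1991] W. G. McCallum, *Kolyvagin's work on Shafarevich–Tate groups*, same volume,
  Lemma 4.3.
* [MilneADT2006] J. S. Milne, *Arithmetic Duality Theorems*, 2nd ed. (2006), Ch. I Prop. 3.8.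
* [HuShuYin2019] Y. Hu, J. Shu, H. Yin, *An explicit Gross–Zagier formula related to the Sylvester
  conjecture*, Trans. AMS 372 (2019), §2 (p. 8: `E_9 ≅ E_p` over `L ⊂ H_{9p}`).
-/

noncomputable section

open scoped Classical NumberField Pointwise

open NumberField IsDedekindDomain Field WeierstrassCurve

namespace Literature.NumberTheory.EllipticCurves

open Literature.NumberTheory.GaloisRepresentations

/-! ## §1 Inertia at an unramified place lies in `Gal(K̄/emb L)` -/

section Inertia

variable {K : Type} [Field K] [NumberField K] {L : Type} [Field L] [Algebra K L]
  [FiniteDimensional K L] [IsGalois K L]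
  (emb : L →+* AlgebraicClosure K)

/-- **Inertia at an unramified place fixes the embedded extension.**  Let `L/K` be finite Galois
with `emb : L → K̄` over `K`, `N = {g ∈ Γ_K : g ∘ emb = emb}` (by `hN`), and `v` a finite place of
`K` unramified in `L`.  Then `I_𝔓 ≤ N` for every prime `𝔓` of `\bar ℤ_K` above `v`: the restriction
`σ ∈ Gal(L/K)` of `g ∈ I_𝔓` lies in the inertia group of `P = 𝔓 ∩ 𝓞 L`, of order `e(P|v) = 1`.
[cite: NeukirchANT1999, Ch. I §9, Prop. (9.6) (#I_𝔓 = e; I_𝔓 = 1 ⟺ 𝔭 unramified in L)] -/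
theorem mem_of_mem_inertia_of_isUnramifiedIn
    (hemb : ∀ k : K, emb (algebraMap K L k) = algebraMap K (AlgebraicClosure K) k)
    (N : Subgroup (absoluteGaloisGroup K))
    (hN : ∀ g, g ∈ N ↔ ∀ x : L,
      (show AlgebraicClosure K ≃ₐ[K] AlgebraicClosure K from g) (emb x) = emb x)
    (v : HeightOneSpectrum (𝓞 K)) (hunr : Algebra.IsUnramifiedIn (R := 𝓞 K) (𝓞 L) v.asIdeal)
    {𝔓 : Ideal (absIntegers (𝓞 K) K)} (h𝔓 : 𝔓 ∈ v.primesAbove)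
    {g : absoluteGaloisGroup K} (hg : g ∈ 𝔓.inertia (absoluteGaloisGroup K)) : g ∈ N := by
  haveI : NumberField L := NumberField.of_module_finite K L
  haveI : Module.Finite (𝓞 K) (𝓞 L) := IsIntegralClosure.finite (𝓞 K) K L (𝓞 L)
  haveI : IsGaloisGroup (L ≃ₐ[K] L) (𝓞 K) (𝓞 L) :=
    IsGaloisGroup.of_isFractionRing (L ≃ₐ[K] L) (𝓞 K) (𝓞 L) K L
  haveI : 𝔓.IsPrime := h𝔓.1
  haveI : 𝔓.LiesOver v.asIdeal := h𝔓.2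
  -- `𝓞 L → \bar ℤ_K` along `emb`
  let ι : 𝓞 L →+* absIntegers (𝓞 K) K :=
    (emb.comp (algebraMap (𝓞 L) L)).codRestrict (integralClosure (𝓞 K) (AlgebraicClosure K))
      fun x ↦ by
        rw [mem_integralClosure_iff]
        have hx : IsIntegral ℤ (emb (algebraMap (𝓞 L) L x)) :=
          (RingOfIntegers.isIntegral_coe x).map emb.toIntAlgHom
        exact hx.tower_top
  have hιcoe : ∀ x : 𝓞 L, ((ι x : absIntegers (𝓞 K) K) : AlgebraicClosure K) = emb (x : L) :=
    fun x ↦ rfl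
  have hιalg : ∀ r : 𝓞 K, ι (algebraMap (𝓞 K) (𝓞 L) r) =
      algebraMap (𝓞 K) (absIntegers (𝓞 K) K) r := fun r ↦ by
    apply Subtype.ext
    rw [hιcoe]
    change emb (algebraMap K L (r : K)) = _
    rw [hemb]
    rfl
  -- the prime `P = 𝔓 ∩ 𝓞 L` below `𝔓`
  set P : Ideal (𝓞 L) := 𝔓.comap ι with hPdef
  haveI hPprime : P.IsPrime := Ideal.comap_isPrime ι 𝔓
  haveI hPover : P.LiesOver v.asIdeal := by
    constructor
    ext r
    rw [h𝔓.2.over, Ideal.under, Ideal.under, Ideal.mem_comap, Ideal.mem_comap, hPdef,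
      Ideal.mem_comap, hιalg]
  -- `e(P | v) = 1`
  haveI : Algebra.IsUnramifiedAt (𝓞 K) P := hunr P hPprime hPover
  have he : P.ramificationIdx (𝓞 K) = 1 := Ideal.ramificationIdx_eq_one_of_isUnramifiedAt
  -- hence the inertia group of `P` in `Gal(L/K)` is trivial
  haveI : v.asIdeal.IsMaximal := v.isMaximal
  have hinertia : P.inertia (L ≃ₐ[K] L) = ⊥ := by
    apply Subgroup.eq_bot_of_card_eq
    rw [Ideal.card_inertia_eq_ramificationIdxIn (G := L ≃ₐ[K] L) v.asIdeal P,
      Ideal.ramificationIdxIn_eq_ramificationIdx v.asIdeal P (L ≃ₐ[K] L), he]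
  -- restrict `g` to `L`
  obtain ⟨σ, hσ⟩ := exists_algEquiv_comp_eq emb hemb g
  have hmem : σ ∈ P.inertia (L ≃ₐ[K] L) := by
    intro y
    change σ • y - y ∈ Ideal.comap ι 𝔓
    rw [Ideal.mem_comap]
    have h1 : ι (σ • y) = g • ι y := by
      apply Subtype.ext
      rw [integralClosure.coe_smul, hιcoe, hιcoe]
      exact (hσ (y : L)).symm
    have hsub : ι (σ • y - y) = g • ι y - ι y := (map_sub ι _ _).trans (by rw [h1])
    exact hsub ▸ hg (ι y)
  rw [hinertia, Subgroup.mem_bot] at hmem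
  exact (hN g).mpr fun x ↦ by rw [hσ x, hmem]; rfl

/-- **Local form**: for `v` unramified in `L`, the restriction `Γ_{K_v} → Γ_K` (`resGal`) maps the
inertia group of every prime `𝔐` of `\bar 𝓞_v` into `N = Gal(K̄/emb L)` — local inertia lands in the
global inertia group of the prime cut out by the embedding `K̄ → K̄_v` (tree
`resGalOfEmb_mem_inertia_primeBelow`, Neukirch II (9.6)). [cite: NeukirchANT1999, Ch. II §9, (9.4)–(9.6)] -/
theorem resGal_mem_of_mem_localInertia_of_isUnramifiedIn
    (hemb : ∀ k : K, emb (algebraMap K L k) = algebraMap K (AlgebraicClosure K) k)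
    (N : Subgroup (absoluteGaloisGroup K))
    (hN : ∀ g, g ∈ N ↔ ∀ x : L,
      (show AlgebraicClosure K ≃ₐ[K] AlgebraicClosure K from g) (emb x) = emb x)
    (v : HeightOneSpectrum (𝓞 K)) (hunr : Algebra.IsUnramifiedIn (R := 𝓞 K) (𝓞 L) v.asIdeal)
    {𝔐 : Ideal (v.localAbsIntegers)} (h𝔐 : 𝔐 ∈ v.localPrimesAbove)
    {σ : absoluteGaloisGroup (v.adicCompletion K)}
    (hσ : σ ∈ 𝔐.inertia (absoluteGaloisGroup (v.adicCompletion K))) :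
    resGal (K := K) (v.adicCompletion K) σ ∈ N :=
  mem_of_mem_inertia_of_isUnramifiedIn emb hemb N hN v hunr
    (v.primeBelow_mem_primesAbove (ι := closureEmb (K := K) (v.adicCompletion K)) h𝔐)
    (v.resGalOfEmb_mem_inertia_primeBelow (closureEmb (K := K) (v.adicCompletion K)) 𝔐 hσ)

end Inertia

/-! ## §2 Ring class fields: local inertia at `v ∤ f` fixes `emb K[f]` -/

section RingClass

variable {K : Type} [Field K] [NumberField K]

/-- **Local inertia at `v ∤ f` lies in `Gal(K̄/emb K[f])`** for the ring class field `K[f]` of an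
imaginary quadratic field `K` (Cox §9.A: `K[f]/K` is unramified at every prime not dividing `f` — the
tree's `isUnramifiedIn_ringClassField`), embedded by `emb : K[f] → K̄` with `N = {g : g ∘ emb = emb}`.
[cite: Cox2013, §9.A (p. 181) with §11.A Thm. 11.1] -/
theorem resGal_mem_of_mem_localInertia_ringClassField (hK : IsImaginaryQuadratic K) (ιK : K →+* ℂ)
    {f : ℕ} (hf : f ≠ 0) (emb : ringClassField K ιK f →+* AlgebraicClosure K)
    (hemb : ∀ k : K, emb (algebraMap K (ringClassField K ιK f) k) = algebraMap K (AlgebraicClosure K) k)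
    (N : Subgroup (absoluteGaloisGroup K))
    (hN : ∀ g, g ∈ N ↔ ∀ x : ringClassField K ιK f,
      (show AlgebraicClosure K ≃ₐ[K] AlgebraicClosure K from g) (emb x) = emb x)
    (v : HeightOneSpectrum (𝓞 K)) (hv : ¬ Ideal.span {((f : ℕ) : 𝓞 K)} ≤ v.asIdeal)
    {𝔐 : Ideal (v.localAbsIntegers)} (h𝔐 : 𝔐 ∈ v.localPrimesAbove)
    {σ : absoluteGaloisGroup (v.adicCompletion K)}
    (hσ : σ ∈ 𝔐.inertia (absoluteGaloisGroup (v.adicCompletion K))) :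
    resGal (K := K) (v.adicCompletion K) σ ∈ N := by
  haveI := (finiteDimensional_and_isGalois_ringClassField hK ιK hf).1
  haveI := (finiteDimensional_and_isGalois_ringClassField hK ιK hf).2
  exact resGal_mem_of_mem_localInertia_of_isUnramifiedIn emb hemb N hN v
    (isUnramifiedIn_ringClassField hK ιK hf hv) h𝔐 hσ

end RingClass

/-! ## §3 Gross's Prop. 6.2 (1) for cubic-twist Kolyvagin classes at the good places -/

section Kolyvagin

open KolyvaginCocycle

variable {K : Type} [Field K] [NumberField K] {W W' : WeierstrassCurve K} [W'.IsElliptic]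

/-- **Gross's Prop. 6.2 (1) for a cubic-twist class.**  Let `ψ : E(K̄) ≃ E'(K̄)` be the transport
`(x, y) ↦ (v²x, v³y)` (`v³ = c`), `N ⊆ Γ_K` a set fixing `v`, `Q ∈ E(K̄)` fixed by `N`, and
`c(ψ Q)` Kolyvagin's class of `ψ Q` (level `n`, admissible `A`).  If `E'` has good reduction at
`w` and the inertia group of a prime `𝔐` of `\bar 𝓞_w` restricts into `N`, then `c(ψ Q)`
satisfies the Selmer local condition at `w`: inertia fixes `ψ Q`
(`JZero.forall_smul_cubicTwist_eq_iff`), so the tree's `kolyvaginClass_mem_selmerLocalKer_of_inertia`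
(the image in `H¹(K_w, E')` is an unramified class, `= 0` by Milne I.3.8) applies.
[cite: GrossLMS1991, Prop. 6.2 (1)] [cite: McCallumLMS1991, Lemma 4.3]
[cite: MilneADT2006, Ch. I Prop. 3.8] [cite: HuShuYin2019, §2 p. 8] -/
theorem JZero.kolyvaginClass_cubicTwist_mem_selmerLocalKer_of_inertia {v : AlgebraicClosure K}
    {ψ : geomPoints W ≃+ geomPoints W'}
    (hψ : ∀ {x y : AlgebraicClosure K}
        (h : (W.baseChange (AlgebraicClosure K)).toAffine.Nonsingular x y),
        ∃ h', ψ (Affine.Point.some x y h) = Affine.Point.some (v ^ 2 * x) (v ^ 3 * y) h')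
    {N : Set (absoluteGaloisGroup K)}
    (hNv : ∀ h ∈ N, (show AlgebraicClosure K ≃ₐ[K] AlgebraicClosure K from h) v = v)
    {A : AddSubgroup (geomPoints W')} {n : ℤ}
    {hdiv : ∀ P : geomPoints W', ∃ R : geomPoints W', n • R = P}
    (hA : IsAdmissible (absoluteGaloisGroup K) A n)
    {Q : geomPoints W} (hQN : ∀ h ∈ N, h • Q = Q)
    (hQ' : ψ Q ∈ invPoints (absoluteGaloisGroup K) A n)
    (w : HeightOneSpectrum (𝓞 K)) (hgood : W'.HasGoodReductionAt w)
    {𝔐 : Ideal (w.localAbsIntegers)} (h𝔐 : 𝔐 ∈ w.localPrimesAbove)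
    (hI : ∀ σ ∈ 𝔐.inertia (absoluteGaloisGroup (w.adicCompletion K)),
      resGal (K := K) (w.adicCompletion K) σ ∈ N) :
    kolyvaginClass W' n hdiv hA (ψ Q) hQ' ∈ selmerLocalKer W' (w.adicCompletion K) n :=
  kolyvaginClass_mem_selmerLocalKer_of_inertia W' hA hQ' w hgood h𝔐 fun σ hσ ↦
    (JZero.forall_smul_cubicTwist_eq_iff hψ hNv Q).mpr hQN _ (hI σ hσ)

/-- **The CM-frame classes are Selmer at the good places off the conductor of the tower field.**
For `K` imaginary quadratic, the ring class field `K[f]` embedded by `emb : K[f] → K̄` over `K`,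
`N ≤ Γ_K` with `g ∈ N ↔ g ∘ emb = emb`, the cubic-twist transport `ψ` with `N` fixing `v`
(printed: `∛c ∈ L ⊂ H_{9p}`), a point `Q ∈ E(K̄)^N = E(K[f])` (`FixedPoints.addSubgroup N`, the recipe's currency), and a finite place `w ∤ f` of
good reduction for `E'`: Kolyvagin's class of `ψ Q` satisfies the Selmer local condition at `w`
(§2: `K[f]/K` is unramified at `w`, so the local inertia lies in `N`; then
`JZero.kolyvaginClass_cubicTwist_mem_selmerLocalKer_of_inertia`).
[cite: GrossLMS1991, Prop. 6.2 (1)] [cite: Cox2013, §9.A (p. 181)] [cite: HuShuYin2019, §2 p. 8] -/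
theorem JZero.kolyvaginClass_cubicTwist_mem_selmerLocalKer_of_ringClassField
    (hK : IsImaginaryQuadratic K) (ιK : K →+* ℂ) {f : ℕ} (hf : f ≠ 0)
    (emb : ringClassField K ιK f →+* AlgebraicClosure K)
    (hemb : ∀ k : K, emb (algebraMap K (ringClassField K ιK f) k) = algebraMap K (AlgebraicClosure K) k)
    (N : Subgroup (absoluteGaloisGroup K))
    (hN : ∀ g, g ∈ N ↔ ∀ x : ringClassField K ιK f,
      (show AlgebraicClosure K ≃ₐ[K] AlgebraicClosure K from g) (emb x) = emb x)
    {v : AlgebraicClosure K} {ψ : geomPoints W ≃+ geomPoints W'}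
    (hψ : ∀ {x y : AlgebraicClosure K}
        (h : (W.baseChange (AlgebraicClosure K)).toAffine.Nonsingular x y),
        ∃ h', ψ (Affine.Point.some x y h) = Affine.Point.some (v ^ 2 * x) (v ^ 3 * y) h')
    (hNv : ∀ h ∈ N, (show AlgebraicClosure K ≃ₐ[K] AlgebraicClosure K from h) v = v)
    {A : AddSubgroup (geomPoints W')} {n : ℤ}
    {hdiv : ∀ P : geomPoints W', ∃ R : geomPoints W', n • R = P}
    (hA : IsAdmissible (absoluteGaloisGroup K) A n)
    {Q : geomPoints W} (hQN : Q ∈ FixedPoints.addSubgroup N (geomPoints W))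
    (hQ' : ψ Q ∈ invPoints (absoluteGaloisGroup K) A n)
    (w : HeightOneSpectrum (𝓞 K)) (hfw : ((f : ℕ) : 𝓞 K) ∉ w.asIdeal)
    (hgood : W'.HasGoodReductionAt w) :
    kolyvaginClass W' n hdiv hA (ψ Q) hQ' ∈ selmerLocalKer W' (w.adicCompletion K) n := by
  obtain ⟨𝔐, h𝔐⟩ := w.localPrimesAbove_nonempty
  have hfw' : ¬ Ideal.span {((f : ℕ) : 𝓞 K)} ≤ w.asIdeal := by
    rwa [Ideal.span_singleton_le_iff_mem]
  exact JZero.kolyvaginClass_cubicTwist_mem_selmerLocalKer_of_inertia hψ (N := (N : Set _)) hNv hA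
    (fun h hh ↦ hQN ⟨h, hh⟩) hQ' w hgood h𝔐 fun σ hσ ↦
      resGal_mem_of_mem_localInertia_ringClassField hK ιK hf emb hemb N hN w hfw' h𝔐 hσ

end Kolyvagin

end Literature.NumberTheory.EllipticCurves
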